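import Literature.Analysis.FluidPDE.TaoAveragedCascadeAssembly
import Literature.Analysis.FluidPDE.TaoAveragedCascadeReduction
import HarnessLib

/-!
# Dilation-free averages of the Euler bilinear operator: closure under finite linear combinations
# and real parts, and the reduction of the dilation-free Theorem 3.2♭ to a single basic form

T. Tao, *Finite time blowup for an averaged three-dimensional Navier–Stokes equation*, J. Amer. Math.
Soc. **29** (2016), 601–674 = arXiv:1402.0290v3, §3.1 p. 15 ("first step: complexification"; "the
space of averages of the Euler bilinear operator is closed under finite linear combinations"), §3.2
¶1, Def. 3.4, §3.4 (3.9) ("a complex average … (without the use of dilation operators)") and Remark 3.5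
(p. 20: "The averaging over dilation operators was only needed to place the base frequencies … where
the non-degeneracy condition (c-nondeg) held … We will however not pursue this matter here").
HONEST FRAMING (cell harvest/h2-tao-ladder, TAO-LADDER rung M_1 = Tao's averaged equation WITHOUT
dilation averaging; MODEL statements): bookkeeping theorems about Tao's averaging data; nothing here
proves the dilation-free single-scale representation at a general base triple (the cell's open crux
R1-a core) and nothing here concerns the true Navier–Stokes equations.

The tree proves Tao's Theorem 3.2 (`localCascade_isAveraged_holds`) through complex averages
`IsComplexAverageOf` whose data may dilate. The dilation-free notion `IsComplexAverageNoDilOf`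
(`TaoAveragedCascadeReduction.lean`: a complex averaging datum with every `λ_{i,θ} = 1`) is used there
only for the single-scale step (3.9). For the dilation-free variant of Theorem 3.2 (the cell's
`SplitCascadeIsAveragedNoDil`) every step must keep `λ ≡ 1`; this file records the steps of §3.1 and
§3.2 ¶1 in that form, reading off that the tree's constructions do not touch the dilation factors:
* `IsComplexAverageNoDilOf.smul_eulerForm`, `.add_eulerForm`, `isComplexAverageNoDilOf_zero_eulerForm`,
  `isComplexAverageNoDilOf_sum_eulerForm` — closure under finite complex linear combinations (the
  data `scale`, `concat`, `AveragingDatum.zero.toComplex` copy / have unit dilation factors);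
* `complexAverageNoDil_isAveragedNoDil` — §3.1: a dilation-free complex average of `B` that is real
  on real fields is `⟨B̃_𝒜(·,·),·⟩` for an averaging datum `𝒜` with `λ ≡ 1` (the realification
  `realParts` keeps the dilation factors);
* `isAveragedNoDil_of_basicNoDil` — the REDUCTION of the dilation-free Theorem 3.2♭ for a class of
  profile triples to its single-form core: if every basic cascade form (3.1) with profiles in the
  class is a dilation-free complex average of `B`, then every finite real combination of such forms
  is `⟨B̃_𝒜(u,v), w⟩` on `H¹⁰_df × H¹⁰_df × (H¹⁰_df ⊗ ℂ)` for a dilation-free `𝒜` (finite sums +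
  realness of cascade forms on real fields + §3.1 + `ℂ`-linearity in `w`, exactly as in the tree's
  `localCascade_isAveraged_of_complexAverage`).
Theorems only.

## References

* T. Tao, J. Amer. Math. Soc. 29 (2016), 601–674 = arXiv:1402.0290v3, §3.1 p. 15, §3.2 ¶1, Def. 3.4,
  §3.4 (3.9), Remark 3.5 p. 20. [`Tao2016AveragedNS`]
-/

noncomputable section

open MeasureTheory Set Filter
open scoped SchwartzMap

namespace Literature.Analysis.FluidPDE.Tao2016

/-! ### §3.2 ¶1 without dilations: finite linear combinations -/

/-- **Scalar multiples**: if `C` is a dilation-free complex average of `B`, so is `c·C` (the scaled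
datum `𝒟.scale c` has the dilation factors of `𝒟`). [cite: Tao2016AveragedNS, §3.2 p. 15] -/
theorem IsComplexAverageNoDilOf.smul_eulerForm {C : L2C → L2C → L2C → ℂ}
    (hC : IsComplexAverageNoDilOf C eulerForm) (c : ℂ) :
    IsComplexAverageNoDilOf (fun u v w => c * C u v w) eulerForm := by
  obtain ⟨𝒟, hlam, h𝒟⟩ := hC
  refine ⟨𝒟.scale c, fun i θ => hlam i θ, fun u v w hu hv hw => ?_⟩
  change c * C u v w = (𝒟.scale c).average eulerForm u v w
  rw [𝒟.scale_average_eulerForm, h𝒟 u v w hu hv hw]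

/-- **Sums**: if `C₁, C₂` are dilation-free complex averages of `B`, so is `C₁ + C₂` (the
concatenated datum has the dilation factors of its summands). [cite: Tao2016AveragedNS, §3.2 p. 15] -/
theorem IsComplexAverageNoDilOf.add_eulerForm {C₁ C₂ : L2C → L2C → L2C → ℂ}
    (h₁ : IsComplexAverageNoDilOf C₁ eulerForm) (h₂ : IsComplexAverageNoDilOf C₂ eulerForm) :
    IsComplexAverageNoDilOf (fun u v w => C₁ u v w + C₂ u v w) eulerForm := by
  obtain ⟨𝒟₁, hlam₁, h𝒟₁⟩ := h₁
  obtain ⟨𝒟₂, hlam₂, h𝒟₂⟩ := h₂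
  refine ⟨𝒟₁.concat 𝒟₂, fun i θ => ?_, fun u v w hu hv hw => ?_⟩
  · cases θ with
    | inl θ => exact hlam₁ i θ
    | inr θ => exact hlam₂ i θ
  · change C₁ u v w + C₂ u v w = (𝒟₁.concat 𝒟₂).average eulerForm u v w
    rw [𝒟₁.concat_average_eulerForm 𝒟₂ hu.1 hv.1, h𝒟₁ u v w hu hv hw, h𝒟₂ u v w hu hv hw]

/-- **The zero form** is a dilation-free complex average of `B` (the empty linear combination of
§3.2 ¶1; the zero datum has `λ ≡ 1`). [cite: Tao2016AveragedNS, §3.2 p. 15] -/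
theorem isComplexAverageNoDilOf_zero_eulerForm :
    IsComplexAverageNoDilOf (fun _ _ _ => (0 : ℂ)) eulerForm :=
  ⟨AveragingDatum.zero.toComplex, fun _ _ => rfl, fun u v w _ _ _ => by
    rw [AveragingDatum.toComplex_average_eulerForm, AveragingDatum.zero_form]⟩

/-- **Closure under finite linear combinations, without dilations** (§3.2 ¶1 read with `λ ≡ 1`).
[cite: Tao2016AveragedNS, §3.2 p. 15] -/
theorem isComplexAverageNoDilOf_sum_eulerForm {ι : Type*} (s : Finset ι) (c : ι → ℂ)
    (C : ι → L2C → L2C → L2C → ℂ) (h : ∀ j ∈ s, IsComplexAverageNoDilOf (C j) eulerForm) :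
    IsComplexAverageNoDilOf (fun u v w => ∑ j ∈ s, c j * C j u v w) eulerForm := by
  classical
  induction s using Finset.induction_on with
  | empty => simpa using isComplexAverageNoDilOf_zero_eulerForm
  | insert a s ha ih =>
    have hrest := ih fun j hj => h j (Finset.mem_insert_of_mem hj)
    have ha' := (h a (Finset.mem_insert_self a s)).smul_eulerForm (c a)
    have := ha'.add_eulerForm hrest
    simpa [Finset.sum_insert ha] using this

/-! ### §3.1 without dilations: real parts -/

/-- **§3.1 with `λ ≡ 1`: a dilation-free complex average of `B` that is real on real fields
`u, v, w ∈ H¹⁰_df` is `⟨B̃_𝒜(u,v), w⟩` for an averaging datum `𝒜` all of whose dilation factors are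
`1`.** The printed realification (decompose the symbols into real and imaginary parts, expand into
eight pieces, keep the even ones, absorb signs into `m_{1,ω}`, concatenate four copies of `(Ω, μ)` and
normalise — the tree's `ComplexAveragingDatum.realParts`) keeps the rotations and the dilation
factors of the datum; the degenerate case `μ = 0` is the zero datum. [cite: Tao2016AveragedNS, §3.1 p. 15] -/
theorem complexAverageNoDil_isAveragedNoDil {T : L2C → L2C → L2C → ℂ}
    (hT : IsComplexAverageNoDilOf T eulerForm)
    (hreal : ∀ u v w, MemH10df u → MemH10df v → MemH10df w → (T u v w).im = 0) :
    ∃ 𝒜 : AveragingDatum, (∀ i θ, 𝒜.lam i θ = 1) ∧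
      ∀ u v w, MemH10df u → MemH10df v → MemH10df w → 𝒜.form u v w = T u v w := by
  obtain ⟨𝒟, hlam, h𝒟⟩ := hT
  by_cases h0 : 𝒟.μ univ = 0
  · refine ⟨AveragingDatum.zero, fun _ _ => rfl, fun u v w hu hv hw => ?_⟩
    rw [AveragingDatum.zero_form, h𝒟 u v w hu.memH10dfC hv.memH10dfC hw.memH10dfC,
      ComplexAveragingDatum.average, Measure.measure_univ_eq_zero.mp h0, integral_zero_measure]
  · refine ⟨𝒟.realParts h0, fun i ω => hlam i ω.1, fun u v w hu hv hw => ?_⟩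
    have hreal' : (𝒟.average eulerForm u v w).im = 0 := by
      rw [← h𝒟 u v w hu.memH10dfC hv.memH10dfC hw.memH10dfC]
      exact hreal u v w hu hv hw
    rw [h𝒟 u v w hu.memH10dfC hv.memH10dfC hw.memH10dfC,
      𝒟.average_eq_integral_even_pieces hu hv hw hreal', 𝒟.realParts_form h0 w hu.1 hv.1]
    have hG := fun a b c => 𝒟.integrable_piece a b c w hu.1 hv.1
    have i1 : Integrable (fun θ => 𝒟.piece true true true u v w θ -
        𝒟.piece true false false u v w θ) 𝒟.μ := (hG _ _ _).sub (hG _ _ _)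
    have i2 : Integrable (fun θ => 𝒟.piece true true true u v w θ -
        𝒟.piece true false false u v w θ - 𝒟.piece false true false u v w θ) 𝒟.μ :=
      i1.sub (hG _ _ _)
    rw [integral_sub i2 (hG _ _ _), integral_sub i1 (hG _ _ _), integral_sub (hG _ _ _) (hG _ _ _),
      Fintype.sum_prod_type]
    simp only [Fintype.sum_bool]
    have s1 : ComplexAveragingDatum.pieceSign (true, true) = 1 := rfl
    have s2 : ComplexAveragingDatum.pieceSign (true, false) = -1 := rfl
    have s3 : ComplexAveragingDatum.pieceSign (false, true) = -1 := rfl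
    have s4 : ComplexAveragingDatum.pieceSign (false, false) = -1 := rfl
    have b1 : (true == true) = true := rfl
    have b2 : (true == false) = false := rfl
    have b3 : (false == true) = false := rfl
    have b4 : (false == false) = true := rfl
    simp only [s1, s2, s3, s4, b1, b2, b3, b4]
    push_cast
    ring

/-! ### The dilation-free Theorem 3.2♭ for a class of profile triples, from its single-form core -/

/-- **Reduction of the dilation-free Theorem 3.2♭ to ONE basic form.** Let `P ε₀` be any property of
profile triples (for the cell's split operators: annular Fourier support refined to balls of radius
`ε₀/64` about `±ζᵢ` with input moduli gap `|‖ζ₁‖ - ‖ζ₂‖| ≥ ε₀/20`). If, for the given `ε₀`, every basic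
cascade form (3.1) whose profile triple satisfies `P ε₀` is a DILATION-FREE complex average of the
Euler form `B`, then every finite real combination `T = ∑ⱼ cⱼ ⟨Cⱼ(·,·),·⟩` of such basic forms is
`⟨B̃_𝒜(u,v), w⟩` on `H¹⁰_df × H¹⁰_df × (H¹⁰_df ⊗ ℂ)` for an averaging datum `𝒜` with `λ ≡ 1`
(rotations and order-zero multipliers only): closure under finite combinations, realness of cascade
forms on real fields (`cascadeCombination_im`), §3.1 without dilations, and `ℂ`-linearity of both
sides in `w` (tree theorems `complexAverage_linear_right_holds`, `memH10dfC_decomposition_holds`).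
[cite: Tao2016AveragedNS, Thm. 3.2, §3.1 p. 15, Remark 3.5 p. 20] -/
theorem isAveragedNoDil_of_basicNoDil {ε₀ : ℝ}
    {P : (Fin 3 → 𝓢(EuclideanSpace ℝ (Fin 3), EuclideanSpace ℝ (Fin 3))) → Prop}
    (hbasic : ∀ ψ : Fin 3 → 𝓢(EuclideanSpace ℝ (Fin 3), EuclideanSpace ℝ (Fin 3)), P ψ →
      IsComplexAverageNoDilOf (basicCascadeForm ε₀ (ψ 0) (ψ 1) (ψ 2)) eulerForm)
    {T : L2C → L2C → L2C → ℂ} {k : ℕ} (c : Fin k → ℝ)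
    (ψ : Fin k → Fin 3 → 𝓢(EuclideanSpace ℝ (Fin 3), EuclideanSpace ℝ (Fin 3)))
    (hψ : ∀ j, P (ψ j))
    (hT : ∀ u v w, MemH10df u → MemH10df v → MemH10dfC w →
      T u v w = ∑ j, (c j : ℂ) * basicCascadeForm ε₀ (ψ j 0) (ψ j 1) (ψ j 2) u v w) :
    ∃ 𝒜 : AveragingDatum, (∀ i θ, 𝒜.lam i θ = 1) ∧
      ∀ u v w, MemH10df u → MemH10df v → MemH10dfC w → 𝒜.form u v w = T u v w := by
  set S : L2C → L2C → L2C → ℂ := fun u v w =>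
    ∑ j, (c j : ℂ) * basicCascadeForm ε₀ (ψ j 0) (ψ j 1) (ψ j 2) u v w with hS
  have hSavg : IsComplexAverageNoDilOf S eulerForm :=
    isComplexAverageNoDilOf_sum_eulerForm Finset.univ (fun j => (c j : ℂ))
      (fun j => basicCascadeForm ε₀ (ψ j 0) (ψ j 1) (ψ j 2)) fun j _ => hbasic _ (hψ j)
  have hSreal : ∀ u v w, MemH10df u → MemH10df v → MemH10df w → (S u v w).im = 0 :=
    fun u v w hu hv hw => cascadeCombination_im ε₀ c ψ hu.2.1 hv.2.1 hw.2.1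
  obtain ⟨𝒜, hlam, h𝒜⟩ := complexAverageNoDil_isAveragedNoDil hSavg hSreal
  obtain ⟨𝒟, -, h𝒟⟩ := hSavg
  refine ⟨𝒜, hlam, fun u v w hu hv hw => ?_⟩
  obtain ⟨w₁, w₂, hw₁, hw₂, rfl⟩ := memH10dfC_decomposition_holds w hw
  rw [hT u v _ hu hv hw]
  change 𝒜.form u v (w₁ + Complex.I • w₂) = S u v (w₁ + Complex.I • w₂)
  have e1 : 𝒜.form u v (w₁ + Complex.I • w₂) =
      𝒜.form u v w₁ + Complex.I * 𝒜.form u v w₂ := by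
    have := AveragingDatum.form_linear_right complexAverage_linear_right_holds 𝒜 1 Complex.I
      hu.memH10dfC hv.memH10dfC hw₁.memH10dfC hw₂.memH10dfC
    rwa [one_smul, one_mul] at this
  have e2 : S u v (w₁ + Complex.I • w₂) = S u v w₁ + Complex.I * S u v w₂ := by
    rw [h𝒟 u v _ hu.memH10dfC hv.memH10dfC hw, h𝒟 u v w₁ hu.memH10dfC hv.memH10dfC hw₁.memH10dfC,
      h𝒟 u v w₂ hu.memH10dfC hv.memH10dfC hw₂.memH10dfC]
    have := complexAverage_linear_right_holds 𝒟 u v w₁ w₂ 1 Complex.I hu.memH10dfC hv.memH10dfC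
      hw₁.memH10dfC hw₂.memH10dfC
    rwa [one_smul, one_mul] at this
  rw [e1, e2, h𝒜 u v w₁ hu hv hw₁, h𝒜 u v w₂ hu hv hw₂]

end Literature.Analysis.FluidPDE.Tao2016
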